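import Summits.ValiantsHypothesis.ValiantsHypothesis.Theorems.LacunarySymmetroidMatrixDescartesCensusDoorA34SheetCoreShadow

/-!
# `MatrixDescartes` census — DOOR A at `(3,4)`: the SEMI-AXIS CORRIDOR on the INDEFINITE sheet — at every middle-type det-root of
# `G + s·(vvᵀ − wwᵀ)` the probe value `s·kᵀGk` lies between the two `d₃`-free frame compressions: `q_v ≤ s·kᵀGk ≤ −q_w`; the type is `sign tr(adj G·|S₃|)`

HONEST FRAMING.  Object-search cell `pub-symmetroid`, engine seat `val-sym-eng-2` (g9); helper row beside the registered strata line
`Cruxes/DoorA34/Lines/strata.lean` on stmt-ValiantsHypothesis-19980 (`DoorA34 = PosRootLawAt 3 4 18`: OPEN, typed, never asserted here), stub `stub_nullTopCeiling`,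
INDEFINITE inertia cell of the singular top letter — the cell of both null-top seventeens of record.  A real symmetric indefinite rank-two `S₃` is `vvᵀ − wwᵀ`
(`v`, `w` its scaled SEMI-AXES, `k = v × w` spans `ker S₃`, `|S₃| := vvᵀ + wwᵀ` its matrix absolute value); the hyperbolic normal form `h·(xyᵀ + yxᵀ)` of
…SheetHyperbolicGraft is `x, y = (v ± w)/√(2h)`-type isotropic directions.  …SheetSemidefBranches (rev 2) proved the branch law for general weights
`F = G + a·vvᵀ + b·wwᵀ`; this file reads it at `(a, b) = (s, −s)`:

* `branchLaw_middle_weights_diag` / `branchLaw_extreme_weights_diag` — the diagonal form for general weights: middle type ⇒ `q_v + b·T ≤ 0 ∧ q_w + a·T ≤ 0`,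
  extreme ⇒ both `≥ 0` (`q_v = vᵀadj(G)v`, `q_w = wᵀadj(G)w`, `T = kᵀGk`);
* **`corridor_middle`** — `F = G + s·vvᵀ + (−s)·wwᵀ` singular of MIDDLE type ⇒ `q_v ≤ s·T` AND `s·T ≤ −q_w`: the probe value `s·kᵀGk` (on the sheet
  `r^{d₃}·kᵀG(r)k`, three terms) sits in the CORRIDOR between the two six-nomial semi-axis compressions of the core adjugate; **`corridor_extreme`** — at an
  extreme-type root the reversed corridor `−q_w ≤ s·T ≤ q_v`;
* **`absTop_typeTest_middle` / `absTop_typeTest_extreme`** — hence `q_v + q_w ≤ 0` at middle-type roots and `≥ 0` at extreme-type roots: the TYPE of a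
  det-root on the indefinite sheet is the sign of `tr(adj G(r)·|S₃|)` — a `d₃`-FREE six-nomial (the unfolding scale CANCELS: `tr(adj F·|S₃|) = tr(adj G·|S₃|)`,
  `trace_adjugate_absTop_graft_free`), the frame-free form of …SheetIsotropicFrame's type-change law `≤ 5`;
* `det_indefTop_two_grafts` — `det F = det G + s·(q_v − q_w) − s²·T` (…SheetTwoGrafts at `(s, −s)`);
* `nullTop_indef_corridor` — the `(3,4)`-pencil form (top letter `S 3 = vvᵀ − wwᵀ`, any support, any real `t`);
* §4 (rev 2) habitat one-liners `indef_middle_probe_pos/neg`, `indef_extreme_probe_pos/neg`, `indef_not_middle_of_compressions_nonneg`: by the sign of the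
  probe `s·kᵀGk`, which semi-axis compression carries the type sign (middle ∧ probe > 0 ⇒ q_w < 0; middle ∧ probe < 0 ⇒ q_v < 0; reversed at extreme).

LOCATED beside it (this seat, report DOOR-A34-ENG2G9 §2: `work/sandwich.py`, 260-digit arithmetic on the seventeen p584238, (0,1,4,100), `|μ₂/μ₁| = 10⁻³⁴·⁷`,
`v` the dominant semi-axis): on the nine core roots and the junction the binding side is `q_v ≤ sT` with `|sT| ≪ |q_v|` (i.e. the TYPE LAW `q_v ≤ 0` of the
flag mechanism); on the four middle-window roots `|sT| ≫ |q_w|` so `sT ≤ −q_w` reads `kᵀG(r)k ≤ 0` (the top trinomial is NEGATIVE across the middle block);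
on the three top-window roots BOTH sides are equalities to `10⁻⁷²…10⁻¹⁰⁶` relative (the kernel vector of `F(r)` is `k` up to `10⁻³⁵`): top-window roots are
exactly attached to the nine-nomials `q_v − t^{d₃}T` and `q_w + t^{d₃}T`.

Nothing here bounds any count; `DoorA34` and all three stubs stay OPEN; registers unchanged (`ζ_sym(3,4) ∈ {18,19}`); nothing on `MatrixDescartes`
(stmt-ValiantsHypothesis-18050) or `VP ≠ VNP` — VP≠VNP not moved.  [folklore] the rank-one adjugate at a singular symmetric matrix; `linarith`.
-/

-- `Summit.ValiantsHypothesis.ValiantsHypothesis.…` repeats a component by the D-0017 layout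
-- (single-conjunct summit), which the `dupNamespace` linter flags; the name is mandated.
set_option linter.dupNamespace false

namespace Summit.ValiantsHypothesis.ValiantsHypothesis.Theorems.LacunarySymmetroidMatrixDescartes.Census

open scoped BigOperators Matrix
open Matrix

/-! ## 1. Diagonal form of the general-weight branch law -/

/-- **Middle type, general weights, diagonal form**: `q_v + b·T ≤ 0` and `q_w + a·T ≤ 0`. [folklore] -/
theorem branchLaw_middle_weights_diag (G : Matrix (Fin 3) (Fin 3) ℝ) (hG : G.IsSymm) (a b : ℝ) (v w : Fin 3 → ℝ)
    (hdet : (G + a • Matrix.vecMulVec v v + b • Matrix.vecMulVec w w).det = 0)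
    (htype : (G + a • Matrix.vecMulVec v v + b • Matrix.vecMulVec w w).adjugate.trace < 0) :
    v ⬝ᵥ (G.adjugate *ᵥ v) + b * ((v ⨯₃ w) ⬝ᵥ (G *ᵥ (v ⨯₃ w))) ≤ 0 ∧
      w ⬝ᵥ (G.adjugate *ᵥ w) + a * ((v ⨯₃ w) ⬝ᵥ (G *ᵥ (v ⨯₃ w))) ≤ 0 := by
  have h1 := branchLaw_middle_weights G hG a b v w hdet htype 1 0
  have h2 := branchLaw_middle_weights G hG a b v w hdet htype 0 1
  rw [one_smul_add_zero_smul] at h1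
  rw [zero_smul_add_one_smul] at h2
  constructor
  · nlinarith [h1]
  · nlinarith [h2]

/-- **Extreme type, general weights, diagonal form**: `0 ≤ q_v + b·T` and `0 ≤ q_w + a·T`. [folklore] -/
theorem branchLaw_extreme_weights_diag (G : Matrix (Fin 3) (Fin 3) ℝ) (hG : G.IsSymm) (a b : ℝ) (v w : Fin 3 → ℝ)
    (hdet : (G + a • Matrix.vecMulVec v v + b • Matrix.vecMulVec w w).det = 0)
    (htype : 0 < (G + a • Matrix.vecMulVec v v + b • Matrix.vecMulVec w w).adjugate.trace) :
    0 ≤ v ⬝ᵥ (G.adjugate *ᵥ v) + b * ((v ⨯₃ w) ⬝ᵥ (G *ᵥ (v ⨯₃ w))) ∧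
      0 ≤ w ⬝ᵥ (G.adjugate *ᵥ w) + a * ((v ⨯₃ w) ⬝ᵥ (G *ᵥ (v ⨯₃ w))) := by
  have h1 := branchLaw_extreme_weights G hG a b v w hdet htype 1 0
  have h2 := branchLaw_extreme_weights G hG a b v w hdet htype 0 1
  rw [one_smul_add_zero_smul] at h1
  rw [zero_smul_add_one_smul] at h2
  constructor
  · nlinarith [h1]
  · nlinarith [h2]

/-! ## 2. The indefinite top letter `S₃ = vvᵀ − wwᵀ` at scale `s`: the CORRIDOR -/

/-- **SEMI-AXIS CORRIDOR, middle type.**  `G` real symmetric, `F = G + s·vvᵀ + (−s)·wwᵀ` (the indefinite rank-two top letter `vvᵀ − wwᵀ` at scale `s`) with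
`det F = 0` and `tr adj F < 0`.  Then `q_v ≤ s·T` and `s·T ≤ −q_w` (`T = kᵀGk`, `k = v × w`): the probe value lies in the corridor between the two frame
compressions of `adj G`. [folklore] -/
theorem corridor_middle (G : Matrix (Fin 3) (Fin 3) ℝ) (hG : G.IsSymm) (s : ℝ) (v w : Fin 3 → ℝ)
    (hdet : (G + s • Matrix.vecMulVec v v + (-s) • Matrix.vecMulVec w w).det = 0)
    (htype : (G + s • Matrix.vecMulVec v v + (-s) • Matrix.vecMulVec w w).adjugate.trace < 0) :
    v ⬝ᵥ (G.adjugate *ᵥ v) ≤ s * ((v ⨯₃ w) ⬝ᵥ (G *ᵥ (v ⨯₃ w))) ∧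
      s * ((v ⨯₃ w) ⬝ᵥ (G *ᵥ (v ⨯₃ w))) ≤ -(w ⬝ᵥ (G.adjugate *ᵥ w)) := by
  obtain ⟨h1, h2⟩ := branchLaw_middle_weights_diag G hG s (-s) v w hdet htype
  constructor
  · linarith
  · linarith

/-- **SEMI-AXIS CORRIDOR, extreme type.**  Same setting with `0 < tr adj F`: `−q_w ≤ s·T ≤ q_v`. [folklore] -/
theorem corridor_extreme (G : Matrix (Fin 3) (Fin 3) ℝ) (hG : G.IsSymm) (s : ℝ) (v w : Fin 3 → ℝ)
    (hdet : (G + s • Matrix.vecMulVec v v + (-s) • Matrix.vecMulVec w w).det = 0)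
    (htype : 0 < (G + s • Matrix.vecMulVec v v + (-s) • Matrix.vecMulVec w w).adjugate.trace) :
    -(w ⬝ᵥ (G.adjugate *ᵥ w)) ≤ s * ((v ⨯₃ w) ⬝ᵥ (G *ᵥ (v ⨯₃ w))) ∧
      s * ((v ⨯₃ w) ⬝ᵥ (G *ᵥ (v ⨯₃ w))) ≤ v ⬝ᵥ (G.adjugate *ᵥ v) := by
  obtain ⟨h1, h2⟩ := branchLaw_extreme_weights_diag G hG s (-s) v w hdet htype
  constructor
  · linarith
  · linarith

/-- **TYPE TEST BY `|S₃|`, middle type**: at a middle-type det-root of `G + s·(vvᵀ − wwᵀ)`, `q_v + q_w ≤ 0`, i.e. `tr(adj G·|S₃|) ≤ 0` with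
`|S₃| = vvᵀ + wwᵀ` — a `d₃`-free test (the scale `s` has cancelled). [folklore] -/
theorem absTop_typeTest_middle (G : Matrix (Fin 3) (Fin 3) ℝ) (hG : G.IsSymm) (s : ℝ) (v w : Fin 3 → ℝ)
    (hdet : (G + s • Matrix.vecMulVec v v + (-s) • Matrix.vecMulVec w w).det = 0)
    (htype : (G + s • Matrix.vecMulVec v v + (-s) • Matrix.vecMulVec w w).adjugate.trace < 0) :
    v ⬝ᵥ (G.adjugate *ᵥ v) + w ⬝ᵥ (G.adjugate *ᵥ w) ≤ 0 := by
  obtain ⟨h1, h2⟩ := corridor_middle G hG s v w hdet htype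
  linarith

/-- **TYPE TEST BY `|S₃|`, extreme type**: at an extreme-type det-root, `0 ≤ q_v + q_w = tr(adj G·|S₃|)`. [folklore] -/
theorem absTop_typeTest_extreme (G : Matrix (Fin 3) (Fin 3) ℝ) (hG : G.IsSymm) (s : ℝ) (v w : Fin 3 → ℝ)
    (hdet : (G + s • Matrix.vecMulVec v v + (-s) • Matrix.vecMulVec w w).det = 0)
    (htype : 0 < (G + s • Matrix.vecMulVec v v + (-s) • Matrix.vecMulVec w w).adjugate.trace) :
    0 ≤ v ⬝ᵥ (G.adjugate *ᵥ v) + w ⬝ᵥ (G.adjugate *ᵥ w) := by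
  obtain ⟨h1, h2⟩ := corridor_extreme G hG s v w hdet htype
  linarith

/-- **The scale cancels in the `|S₃|`-trace**: `vᵀ adj(F) v + wᵀ adj(F) w = vᵀ adj(G) v + wᵀ adj(G) w` for `F = G + s·vvᵀ + (−s)·wwᵀ`
(any commutative ring) — the `|S₃|`-compression of the adjugate pencil is `d₃`-free on the indefinite sheet. [folklore] -/
theorem trace_adjugate_absTop_graft_free {R : Type*} [CommRing R] (G : Matrix (Fin 3) (Fin 3) R) (s : R) (v w : Fin 3 → R) :
    v ⬝ᵥ ((G + s • Matrix.vecMulVec v v + (-s) • Matrix.vecMulVec w w).adjugate *ᵥ v)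
        + w ⬝ᵥ ((G + s • Matrix.vecMulVec v v + (-s) • Matrix.vecMulVec w w).adjugate *ᵥ w)
      = v ⬝ᵥ (G.adjugate *ᵥ v) + w ⬝ᵥ (G.adjugate *ᵥ w) := by
  rw [adjugate_quadForm_add_two_grafts_left, adjugate_quadForm_add_two_grafts_right]
  ring

/-- The indefinite two-graft determinant in blocks: `det(G + s·vvᵀ + (−s)·wwᵀ) = det G + s·(q_v − q_w) − s²·kᵀGk`. [folklore] -/
theorem det_indefTop_two_grafts (G : Matrix (Fin 3) (Fin 3) ℝ) (s : ℝ) (v w : Fin 3 → ℝ) :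
    (G + s • Matrix.vecMulVec v v + (-s) • Matrix.vecMulVec w w).det
      = G.det + s * (v ⬝ᵥ (G.adjugate *ᵥ v) - w ⬝ᵥ (G.adjugate *ᵥ w)) - s ^ 2 * ((v ⨯₃ w) ⬝ᵥ (G *ᵥ (v ⨯₃ w))) := by
  rw [det_add_two_smul_vecMulVec_fin_three]
  ring

/-! ## 3. The sheet reading -/

/-- The null-top pencil with indefinite top letter `S₃ = vvᵀ − wwᵀ` evaluated at `t`. [folklore] -/
theorem eval_pencil_indefTop (d : Fin 4 → ℕ) (S : Fin 4 → Matrix (Fin 3) (Fin 3) ℝ) (v w : Fin 3 → ℝ)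
    (h3 : S 3 = Matrix.vecMulVec v v - Matrix.vecMulVec w w) (t : ℝ) :
    (∑ l, t ^ d l • S l) = (∑ l : Fin 3, t ^ d (Fin.castSucc l) • S (Fin.castSucc l))
        + t ^ d 3 • Matrix.vecMulVec v v + (-(t ^ d 3)) • Matrix.vecMulVec w w := by
  have h3' : S (Fin.last 3) = Matrix.vecMulVec v v - Matrix.vecMulVec w w := h3
  rw [Fin.sum_univ_castSucc, h3', smul_sub, neg_smul, ← sub_eq_add_neg, add_sub_assoc]
  rfl

/-- **SEMI-AXIS CORRIDOR ON THE INDEFINITE SHEET** (all supports).  A real symmetric `(3,4)` pencil with top letter `S₃ = vvᵀ − wwᵀ` (indefinite of rank two),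
a real `t` with `det F(t) = 0` of MIDDLE type: with the three-letter core `G(t)`, `q_v(t) ≤ t^{d₃}·kᵀG(t)k ≤ −q_w(t)` (`k = v × w`); at an EXTREME-type root the
corridor is reversed.  Both seventeens of record are all-middle: at each of their roots the three-term probe sits in this corridor. [folklore] -/
theorem nullTop_indef_corridor (d : Fin 4 → ℕ) (S : Fin 4 → Matrix (Fin 3) (Fin 3) ℝ) (hS : ∀ l, (S l).IsSymm) (v w : Fin 3 → ℝ)
    (h3 : S 3 = Matrix.vecMulVec v v - Matrix.vecMulVec w w) (t : ℝ) (hdet : (∑ l, t ^ d l • S l).det = 0) :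
    ((∑ l, t ^ d l • S l).adjugate.trace < 0 →
      v ⬝ᵥ ((∑ l : Fin 3, t ^ d (Fin.castSucc l) • S (Fin.castSucc l)).adjugate *ᵥ v)
          ≤ t ^ d 3 * ((v ⨯₃ w) ⬝ᵥ ((∑ l : Fin 3, t ^ d (Fin.castSucc l) • S (Fin.castSucc l)) *ᵥ (v ⨯₃ w))) ∧
        t ^ d 3 * ((v ⨯₃ w) ⬝ᵥ ((∑ l : Fin 3, t ^ d (Fin.castSucc l) • S (Fin.castSucc l)) *ᵥ (v ⨯₃ w)))
          ≤ -(w ⬝ᵥ ((∑ l : Fin 3, t ^ d (Fin.castSucc l) • S (Fin.castSucc l)).adjugate *ᵥ w))) ∧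
    (0 < (∑ l, t ^ d l • S l).adjugate.trace →
      -(w ⬝ᵥ ((∑ l : Fin 3, t ^ d (Fin.castSucc l) • S (Fin.castSucc l)).adjugate *ᵥ w))
          ≤ t ^ d 3 * ((v ⨯₃ w) ⬝ᵥ ((∑ l : Fin 3, t ^ d (Fin.castSucc l) • S (Fin.castSucc l)) *ᵥ (v ⨯₃ w))) ∧
        t ^ d 3 * ((v ⨯₃ w) ⬝ᵥ ((∑ l : Fin 3, t ^ d (Fin.castSucc l) • S (Fin.castSucc l)) *ᵥ (v ⨯₃ w)))
          ≤ v ⬝ᵥ ((∑ l : Fin 3, t ^ d (Fin.castSucc l) • S (Fin.castSucc l)).adjugate *ᵥ v)) := by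
  have hG : (∑ l : Fin 3, t ^ d (Fin.castSucc l) • S (Fin.castSucc l)).IsSymm := by
    unfold Matrix.IsSymm
    rw [Matrix.transpose_sum]
    refine Finset.sum_congr rfl fun l _ => ?_
    rw [Matrix.transpose_smul, (hS _)]
  rw [eval_pencil_indefTop d S v w h3 t] at hdet ⊢
  exact ⟨fun htype => corridor_middle _ hG _ v w hdet htype, fun htype => corridor_extreme _ hG _ v w hdet htype⟩

/-! ## 4. HABITAT on the indefinite sheet (appended, rev 2): which semi-axis compression carries the type, by the sign of the probe -/

/-- **Middle type, positive probe** (`0 < s·kᵀGk`): the NEGATIVE semi-axis compression is negative, `q_w < 0`. [folklore] -/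
theorem indef_middle_probe_pos (G : Matrix (Fin 3) (Fin 3) ℝ) (hG : G.IsSymm) (s : ℝ) (v w : Fin 3 → ℝ)
    (hdet : (G + s • Matrix.vecMulVec v v + (-s) • Matrix.vecMulVec w w).det = 0)
    (htype : (G + s • Matrix.vecMulVec v v + (-s) • Matrix.vecMulVec w w).adjugate.trace < 0)
    (hT : 0 < s * ((v ⨯₃ w) ⬝ᵥ (G *ᵥ (v ⨯₃ w)))) : w ⬝ᵥ (G.adjugate *ᵥ w) < 0 := by
  obtain ⟨_, h2⟩ := corridor_middle G hG s v w hdet htype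
  linarith

/-- **Middle type, negative probe** (`s·kᵀGk < 0`): the POSITIVE semi-axis compression is negative, `q_v < 0`. [folklore] -/
theorem indef_middle_probe_neg (G : Matrix (Fin 3) (Fin 3) ℝ) (hG : G.IsSymm) (s : ℝ) (v w : Fin 3 → ℝ)
    (hdet : (G + s • Matrix.vecMulVec v v + (-s) • Matrix.vecMulVec w w).det = 0)
    (htype : (G + s • Matrix.vecMulVec v v + (-s) • Matrix.vecMulVec w w).adjugate.trace < 0)
    (hT : s * ((v ⨯₃ w) ⬝ᵥ (G *ᵥ (v ⨯₃ w))) < 0) : v ⬝ᵥ (G.adjugate *ᵥ v) < 0 := by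
  obtain ⟨h1, _⟩ := corridor_middle G hG s v w hdet htype
  linarith

/-- **Extreme type, positive probe**: `0 < q_v`. [folklore] -/
theorem indef_extreme_probe_pos (G : Matrix (Fin 3) (Fin 3) ℝ) (hG : G.IsSymm) (s : ℝ) (v w : Fin 3 → ℝ)
    (hdet : (G + s • Matrix.vecMulVec v v + (-s) • Matrix.vecMulVec w w).det = 0)
    (htype : 0 < (G + s • Matrix.vecMulVec v v + (-s) • Matrix.vecMulVec w w).adjugate.trace)
    (hT : 0 < s * ((v ⨯₃ w) ⬝ᵥ (G *ᵥ (v ⨯₃ w)))) : 0 < v ⬝ᵥ (G.adjugate *ᵥ v) := by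
  obtain ⟨_, h2⟩ := corridor_extreme G hG s v w hdet htype
  linarith

/-- **Extreme type, negative probe**: `0 < q_w`. [folklore] -/
theorem indef_extreme_probe_neg (G : Matrix (Fin 3) (Fin 3) ℝ) (hG : G.IsSymm) (s : ℝ) (v w : Fin 3 → ℝ)
    (hdet : (G + s • Matrix.vecMulVec v v + (-s) • Matrix.vecMulVec w w).det = 0)
    (htype : 0 < (G + s • Matrix.vecMulVec v v + (-s) • Matrix.vecMulVec w w).adjugate.trace)
    (hT : s * ((v ⨯₃ w) ⬝ᵥ (G *ᵥ (v ⨯₃ w))) < 0) : 0 < w ⬝ᵥ (G.adjugate *ᵥ w) := by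
  obtain ⟨h1, _⟩ := corridor_extreme G hG s v w hdet htype
  linarith

/-- **No middle-type root where both semi-axis compressions are non-negative** (`0 ≤ q_v`, `0 ≤ q_w`, not both zero with the probe):
contrapositive packaging of the corridor — if `0 ≤ q_v` and `0 ≤ q_w` and `(q_v, q_w) ≠ (0,0)`-in-the-sense `0 < q_v + q_w`, a det-root there is NOT of middle
type. [folklore] -/
theorem indef_not_middle_of_compressions_nonneg (G : Matrix (Fin 3) (Fin 3) ℝ) (hG : G.IsSymm) (s : ℝ) (v w : Fin 3 → ℝ)
    (hdet : (G + s • Matrix.vecMulVec v v + (-s) • Matrix.vecMulVec w w).det = 0)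
    (hsum : 0 < v ⬝ᵥ (G.adjugate *ᵥ v) + w ⬝ᵥ (G.adjugate *ᵥ w)) :
    0 ≤ (G + s • Matrix.vecMulVec v v + (-s) • Matrix.vecMulVec w w).adjugate.trace := by
  by_contra hlt
  have h := absTop_typeTest_middle G hG s v w hdet (not_le.mp hlt)
  linarith

end Summit.ValiantsHypothesis.ValiantsHypothesis.Theorems.LacunarySymmetroidMatrixDescartes.Census
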